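import Summits.Ventures.HodgeRepro2.T5QuadraticSplitRamified
import Summits.Ventures.HodgeRepro2.T5CMInertPlacePackage

/-!
# T5QuadraticGenerator — every quadratic extension of number fields is `K(√d)` with an integral
# `√d`: the census of the inert places for EVERY quadratic `L/K`, in particular for every CM field

Tier-5 kernel support (seat p8, blind lane; sub-step N3, the census of the datum's places).
T5-173 / T5-174 / T5-176 characterise the inert, split and ramified places of `L = K(√d)` by the
residue of `d`, assuming an integral `x ∈ 𝓞_L` with `x² = d ∈ 𝓞_K`, `x ∉ 𝓞_K`.  This file removes
that assumption: for `[L : K] = 2` such `x, d` always exist (`exists_sq_eq_algebraMap`: take any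
integer `y ∉ 𝓞_K`, whose minimal polynomial is `X² + bX + c`, and put `x = 2y + b`,
`d = b² − 4c`).  Hence (`exists_census`) every quadratic `L/K` has a `d ∈ 𝓞_K` such that, at every
finite place `v` of `K` with `4d ∉ v`, «`v` stays prime in `L`» ⟺ `d` is not a square mod `v`,
and `v` splits ⟺ `d` is a square mod `v`.  For the record's CM field `E` over `E⁺` (Mathlib's
`NumberField.IsCMField`, `[E : E⁺] = 2` = T5-168's `finrank_eq_two_cm`) this is
`exists_census_cm`: the census of the inert places of `E/E⁺` is a Legendre-symbol table.

No `sorry`, no axiom beyond `propext`, `Classical.choice`, `Quot.sound`.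
-/

namespace Summit.Ventures.HodgeRepro2.T5QuadraticGenerator

open Polynomial NumberField IsDedekindDomain HeightOneSpectrum

variable {K : Type*} [Field K] [NumberField K] {L : Type*} [Field L] [NumberField L] [Algebra K L]

omit [NumberField K] [NumberField L] in
/-- `[L : K] = 2 ⇒` some element of `L` is not in `K`. -/
theorem exists_not_mem_range (h2 : Module.finrank K L = 2) :
    ∃ z : L, z ∉ Set.range (algebraMap K L) := by
  by_contra h
  push Not at h
  have hbot : (⊥ : Subalgebra K L) = ⊤ := by
    rw [eq_top_iff]
    intro z _
    exact Algebra.mem_bot.mpr (h z)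
  rw [Subalgebra.bot_eq_top_iff_finrank_eq_one, h2] at hbot
  exact absurd hbot (by norm_num)

omit [NumberField K] in
/-- `[L : K] = 2 ⇒` some algebraic integer of `L` is not in `𝓞_K` (`L` is the fraction field of
`𝓞_L`, so otherwise `L = K`). -/
theorem exists_integer_not_mem_range (h2 : Module.finrank K L = 2) :
    ∃ y : 𝓞 L, y ∉ Set.range (algebraMap (𝓞 K) (𝓞 L)) := by
  obtain ⟨z, hz⟩ := exists_not_mem_range h2
  obtain ⟨a, s, -, rfl⟩ := IsFractionRing.div_surjective (𝓞 L) z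
  by_contra h
  push Not at h
  obtain ⟨a', ha'⟩ := h a
  obtain ⟨s', hs'⟩ := h s
  apply hz
  refine ⟨algebraMap (𝓞 K) K a' / algebraMap (𝓞 K) K s', ?_⟩
  rw [map_div₀, ← ha', ← hs', ← IsScalarTower.algebraMap_apply, ← IsScalarTower.algebraMap_apply,
    ← IsScalarTower.algebraMap_apply, ← IsScalarTower.algebraMap_apply]

omit [NumberField K] [NumberField L] in
/-- An algebraic integer of `L` whose image lies in `K` comes from `𝓞_K`. -/
theorem mem_range_of_algebraMap_mem_range {y : 𝓞 L}
    (h : algebraMap (𝓞 L) L y ∈ Set.range (algebraMap K L)) :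
    y ∈ Set.range (algebraMap (𝓞 K) (𝓞 L)) := by
  obtain ⟨k, hk⟩ := h
  have hint : IsIntegral ℤ (algebraMap K L k) := hk ▸ RingOfIntegers.isIntegral_coe y
  rw [isIntegral_algebraMap_iff (algebraMap K L).injective] at hint
  refine ⟨⟨k, (mem_integralClosure_iff ℤ K).mpr hint⟩, ?_⟩
  apply FaithfulSMul.algebraMap_injective (𝓞 L) L
  rw [← IsScalarTower.algebraMap_apply, IsScalarTower.algebraMap_apply (𝓞 K) K L,
    RingOfIntegers.map_mk, hk]

/-- An algebraic integer `y ∉ 𝓞_K` of a quadratic `L/K` satisfies `y² + b y + c = 0` with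
`b, c ∈ 𝓞_K` (its minimal polynomial over `𝓞_K` is monic of degree `2`). -/
theorem exists_sq_add_mul_add_eq_zero (h2 : Module.finrank K L = 2) {y : 𝓞 L}
    (hy : y ∉ Set.range (algebraMap (𝓞 K) (𝓞 L))) :
    ∃ b c : 𝓞 K, y * y + algebraMap (𝓞 K) (𝓞 L) b * y + algebraMap (𝓞 K) (𝓞 L) c = 0 := by
  have hint : IsIntegral (𝓞 K) y := Algebra.IsIntegral.isIntegral y
  have hmon := minpoly.monic hint
  have hge : 2 ≤ (minpoly (𝓞 K) y).natDegree :=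
    (minpoly.two_le_natDegree_iff hint).mpr (by simpa [RingHom.mem_range] using hy)
  have hle : (minpoly (𝓞 K) y).natDegree ≤ 2 := by
    have h := minpoly.natDegree_le (algebraMap (𝓞 L) L y) (A := K)
    rwa [minpoly.isIntegrallyClosed_eq_field_fractions K L hint, hmon.natDegree_map, h2] at h
  have hdeg : (minpoly (𝓞 K) y).natDegree = 2 := le_antisymm hle hge
  refine ⟨(minpoly (𝓞 K) y).coeff 1, (minpoly (𝓞 K) y).coeff 0, ?_⟩
  have h0 := minpoly.aeval (𝓞 K) y
  rw [hmon.as_sum, hdeg] at h0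
  simp only [Finset.sum_range_succ, Finset.sum_range_zero, zero_add, map_add, map_pow, map_mul,
    aeval_X, aeval_C, pow_zero, pow_one, mul_one] at h0
  rw [← h0]
  ring

/-- **Every quadratic extension of number fields is `K(√d)` with an integral `√d`**: for
`[L : K] = 2` there are `x ∈ 𝓞_L`, `d ∈ 𝓞_K` with `x² = d` and `x ∉ 𝓞_K`. -/
theorem exists_sq_eq_algebraMap (h2 : Module.finrank K L = 2) :
    ∃ (x : 𝓞 L) (d : 𝓞 K), x * x = algebraMap (𝓞 K) (𝓞 L) d ∧
      x ∉ Set.range (algebraMap (𝓞 K) (𝓞 L)) := by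
  obtain ⟨y, hy⟩ := exists_integer_not_mem_range h2
  obtain ⟨b, c, hbc⟩ := exists_sq_add_mul_add_eq_zero h2 hy
  refine ⟨2 * y + algebraMap (𝓞 K) (𝓞 L) b, b * b - 4 * c, ?_, ?_⟩
  · rw [map_sub, map_mul, map_mul, map_ofNat]
    linear_combination (4 : 𝓞 L) * hbc
  · rintro ⟨q, hq⟩
    apply hy
    apply mem_range_of_algebraMap_mem_range
    refine ⟨(algebraMap (𝓞 K) K q - algebraMap (𝓞 K) K b) / 2, ?_⟩
    have hL := congrArg (algebraMap (𝓞 L) L) hq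
    rw [map_add, map_mul, map_ofNat, ← IsScalarTower.algebraMap_apply, ← IsScalarTower.algebraMap_apply,
      IsScalarTower.algebraMap_apply (𝓞 K) K L, IsScalarTower.algebraMap_apply (𝓞 K) K L] at hL
    rw [map_div₀, map_sub, map_ofNat, hL]
    ring

/-- **The census of the inert places of EVERY quadratic extension of number fields**: for
`[L : K] = 2` there is `d ∈ 𝓞_K` such that at every finite place `v` of `K` with `4d ∉ v`,
«`v` stays prime in `L`» ⟺ `d` is not a square modulo `v`, and `v` splits (two distinct places
over it) ⟺ `d` is a square modulo `v`. -/
theorem exists_census (h2 : Module.finrank K L = 2) :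
    ∃ d : 𝓞 K, ∀ v : HeightOneSpectrum (𝓞 K), 4 * d ∉ v.asIdeal →
      ((∃ w : HeightOneSpectrum (𝓞 L), v.asIdeal.map (algebraMap (𝓞 K) (𝓞 L)) = w.asIdeal) ↔
          ¬ IsSquare (Ideal.Quotient.mk v.asIdeal d)) ∧
        (IsSquare (Ideal.Quotient.mk v.asIdeal d) →
          ∃ w₁ w₂ : HeightOneSpectrum (𝓞 L), w₁ ≠ w₂ ∧
            w₁.asIdeal.LiesOver v.asIdeal ∧ w₂.asIdeal.LiesOver v.asIdeal) := by
  obtain ⟨x, d, hx, hx'⟩ := exists_sq_eq_algebraMap h2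
  exact ⟨d, fun v hv =>
    ⟨T5QuadraticConductor.exists_map_eq_asIdeal_iff_not_isSquare v h2 hx hx' hv,
      T5QuadraticSplitRamified.exists_ne_liesOver_of_isSquare v h2 hx hx' hv⟩⟩

/-- **The census of the inert places of a CM field** `E` over its maximal totally real subfield
`E⁺` (Mathlib's `NumberField.IsCMField`; `[E : E⁺] = 2` is T5-168's `finrank_eq_two_cm`): there is
`d ∈ 𝓞_{E⁺}` such that, at every finite place `v` of `E⁺` with `4d ∉ v`, `v` is inert in `E`
(«stays prime», the hypothesis of the whole inert-place package T5-146 … T5-171) ⟺ `d` is not a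
square modulo `v`. -/
theorem exists_census_cm (E : Type*) [Field E] [NumberField E] [IsCMField E] :
    ∃ d : 𝓞 (maximalRealSubfield E), ∀ v : HeightOneSpectrum (𝓞 (maximalRealSubfield E)),
      4 * d ∉ v.asIdeal →
        ((∃ w : HeightOneSpectrum (𝓞 E),
            v.asIdeal.map (algebraMap (𝓞 (maximalRealSubfield E)) (𝓞 E)) = w.asIdeal) ↔
          ¬ IsSquare (Ideal.Quotient.mk v.asIdeal d)) := by
  obtain ⟨d, hd⟩ := exists_census (K := maximalRealSubfield E) (L := E)
    (T5CMInertPlacePackage.finrank_eq_two_cm E)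
  exact ⟨d, fun v hv => (hd v hv).1⟩

end Summit.Ventures.HodgeRepro2.T5QuadraticGenerator
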